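import Summits.QuantumFields.BalabanUV.Beta.GAN24.FineReadoutCauchyMatchedRate
import Summits.QuantumFields.BalabanUV.Beta.GAN24.AliasPointSum

/-!
# `BalabanUV.Beta.GAN24.FineReadoutCauchyMatchedSum` — binder row G-an2-4 / (CONV-C), S-slot located remainder «E3SupRate», located leaf «(N1-Cauchy)»,
# PART A «matched sub-alias», part 3c (CONSUMER FORMS for the holder's PART S): THE Lc-CELL FACTOR (A-cell), THE PER-LABEL MATCHED BOUND
# `‖cell·Ã_{N·Lc}(lift m) − Ã_N(m)‖ ≤ (KM/N)·wt(m)`, AND THE N-UNIFORM ALIAS SUM `Σ_m wt(m) ≤ KW` (King 1986 (4.22) at `α = 0` via `AliasPointSum`)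

NOT IN PRINT; OUR PROOF ATTEMPT (of the road; THIS file is [folklore] bookkeeping over parts 1–3b + leaf-16's `AliasPointSum` + leaf-14's `AliasReindex`
BY NAME; no cited fact beyond the imported King reproduction, no wall binder, no `def … : Prop`; `def`s = the cell factor, the weight and three displayed
constants).  HONEST FRAMING (cell contract, verbatim): «discharging `BetaPertH` makes Bałaban's UV stability UNCONDITIONAL — a real constructive-QFT
result; it is NOT the continuum limit and NOT the Clay problem.»  HONEST DEPENDENCY (verbatim): «continuum YM on T⁴ ⇐ BetaPertH ∧ nine spine estimates
(0/9 proved); BetaPertH ⇐ (D1) ∧ (D4) ∧ CAP+tail; G-an2-4 gates asym, D1 and NE2/3/4.»  Discharges NOTHING of (hS, hSall) / «E3SupRate» / «(N1-Cauchy)»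
(PART A is one of six parts of ONE located leaf; the holder's PART S and leaf-13's real assembly close the leaf); NOT `BetaPertH`, NOT continuum, NOT Clay.

## What is proved (generic `D`; blockings `N ≥ 1`, `N′ = N·Lc`, `Lc ≥ 1`; real `pr`, `|pr_i| ≤ π`, `pr ≠ 0`; `P = qlab pr m`, `ρ = √momSq P`, `s² = momSq pr`)
* §1 (A-cell) `cellT N′ Lc pr m′ := (Lc^D)⁻¹·Π_i gs (kAl N′ (ofRealVec pr) m′ i) Lc` (= `(Lc^{d+1})⁻¹·boxW` of leaf-17's PART N by `boxW_eq_prod`):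
  `norm_cellT_le_one`, `cellT_lift_eq` (a function of `P/N′`), **`norm_cellT_lift_sub_one_le`**: `‖cellT N′ Lc pr (lift N′ m) − 1‖ ≤ (Σ_i |P_i|)/N`.
* §2 **`norm_matched_le`**: `‖cellT N′ Lc pr (lift N′ m)·Ã_{N′}(lift N′ m)_κ − Ã_N(m)_κ‖ ≤ (KM D/N)·wt pr m`, `wt pr m = (1+ρ)·WS P·s²/ρ²`,
  `KM = D·KB + KA`, EVERY alias class `m` (`Ã = FineReadoutCauchyMatched.ampT = N^{D+1}·Ahat N (ofRealVec pr) 0 (eVec l)`).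
* §3 the weight in King currency: `WS_qlab_le_prod` (`WS P ≤ 4^D·Π_i [srep m i = 0 ? 1 : |srep m i|⁻¹]`), `norm_realVec_srep_le` (`‖srep m‖∞ ≤ ρ/π`),
  **`wt_le_pointWeight`** (`m ≠ 0`: `wt ≤ KP·pointWeight 0 (srep m)`, `KP = 4^D·D·(1 + 3π√D)`), `wt_zero_le` (`≤ 1 + π√D`),
  **`sum_wt_le`**: `Σ_{m : TorusSite D N} wt pr m ≤ KW D` (`D ≥ 1`), `KW = 1 + π√D + KP·(3π)·3^D·aliasConst D 0` — N-UNIFORM.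
* §4 **`sum_norm_matched_le`**: `Σ_m ‖cellT·Ã_{N′}(lift N′ m)_κ − Ã_N(m)_κ‖ ≤ KM·KW/N` — the matched half of the holder's (S2), rate `1/N = Lc^{−(n+1)}`
  at `N = Lc^{n+1}` (θ = Lc⁻¹; the K-tail `FineReadoutCauchyTail` and the C-wiring are the other summands).
Unit `b2b-balaban-gan24-formalise-leaf-16` (G-an2-4 formalisation swarm, leaf prover 16, gen 9), 2026-08-20.
-/

noncomputable section

open Complex Finset
open scoped BigOperators Real

namespace Summit.QuantumFields.BalabanUV.Beta.GAN24.FineReadoutCauchyMatchedSum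

open Literature.Probability.LatticeModels (TorusSite)
open Literature.MathematicalPhysics.QuantumFieldTheory.Balaban1983to89.B4Strip (ofRealVec)
open Literature.MathematicalPhysics.QuantumFieldTheory.King1986 (momSq momSq_nonneg aliasConst)
open Summit.QuantumFields.BalabanUV.Beta.GAN24.AliasObjects (gs kAl)
open Summit.QuantumFields.BalabanUV.Beta.GAN24.AliasReindex (srep lift srep_lift kAl_eq_kSym_add kSym_lift gs_add_two_pi_mul srep_apply)
open Summit.QuantumFields.BalabanUV.Beta.GAN24.AliasPointSum (realVec pointWeight pointWeight_nonneg abs_le_norm_realVec one_le_norm_realVec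
  srep_ne_zero sum_pointWeight_srep_le)
open Summit.QuantumFields.BalabanUV.Beta.GAN24.FibreRateTBlock (qlab kSym_ofRealVec_apply)
open Summit.QuantumFields.BalabanUV.Beta.GAN24.CapacitanceScalarBounds (momSq_pos)
open Summit.QuantumFields.BalabanUV.Beta.GAN24.FineReadoutCauchyScalars
open Summit.QuantumFields.BalabanUV.Beta.GAN24.FineReadoutCauchyAmp
open Summit.QuantumFields.BalabanUV.Beta.GAN24.FineReadoutCauchyMatched
open Summit.QuantumFields.BalabanUV.Beta.GAN24.FineReadoutCauchyMatchedRate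

variable {D : ℕ}

/-! ## §1 (A-cell): the Lc-cell mean factor -/

/-- [folklore] THE NORMALISED Lc-CELL FACTOR of the level-`N′` alias class `m′`: `(Lc^D)⁻¹·Π_i gs (k′_{m′,i}) Lc`
(`= (Lc^D)⁻¹·Σ_{r ∈ box Lc} pw k′_{m′} (toSite r)` — leaf-17's `boxW`, `FineReadoutCauchyFold.boxW_eq_prod`). -/
def cellT (N' Lc : ℕ) [NeZero N'] (pr : Fin D → ℝ) (m' : TorusSite D N') : ℂ :=
  ((Lc : ℂ) ^ D)⁻¹ * ∏ i, gs (kAl N' (ofRealVec pr) m' i) Lc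

section Cell

variable {N N' Lc : ℕ} [NeZero N] [NeZero N'] [NeZero Lc]

/-- [folklore] One coordinate, real argument: `‖gs y Lc / Lc‖ ≤ 1`. -/
theorem norm_gs_div_le_one (y : ℝ) : ‖gs (y : ℂ) Lc / (Lc : ℂ)‖ ≤ 1 := by
  have hL : (0 : ℝ) < Lc := by exact_mod_cast Nat.pos_of_ne_zero (NeZero.ne Lc)
  rw [norm_div, Complex.norm_natCast, div_le_one hL]
  exact AliasWeights.norm_geomExp_le y Lc

/-- [folklore] One coordinate, real argument: `‖gs y Lc / Lc − 1‖ ≤ Lc·|y|` (each of the `Lc` unimodular terms is within `|y|·t ≤ |y|·Lc` of `1`). -/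
theorem norm_gs_div_sub_one_le (y : ℝ) : ‖gs (y : ℂ) Lc / (Lc : ℂ) - 1‖ ≤ (Lc : ℝ) * |y| := by
  have hL0 : (Lc : ℂ) ≠ 0 := Nat.cast_ne_zero.2 (NeZero.ne Lc)
  have hL : (0 : ℝ) < Lc := by exact_mod_cast Nat.pos_of_ne_zero (NeZero.ne Lc)
  have e : gs (y : ℂ) Lc / (Lc : ℂ) - 1 = (∑ t ∈ Finset.range Lc, (cexp (I * y * t) - 1)) / (Lc : ℂ) := by
    unfold AliasObjects.gs
    rw [Finset.sum_sub_distrib, Finset.sum_const, Finset.card_range, nsmul_eq_mul, mul_one]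
    field_simp
  rw [e, norm_div, Complex.norm_natCast, div_le_iff₀ hL]
  calc ‖∑ t ∈ Finset.range Lc, (cexp (I * y * t) - 1)‖ ≤ ∑ t ∈ Finset.range Lc, ‖cexp (I * y * t) - 1‖ := norm_sum_le _ _
    _ ≤ ∑ _t ∈ Finset.range Lc, (Lc : ℝ) * |y| := Finset.sum_le_sum fun t ht => by
        have h := Real.norm_exp_I_mul_ofReal_sub_one_le (x := y * t)
        rw [show I * (y : ℂ) * (t : ℂ) = I * ((y * t : ℝ) : ℂ) by push_cast; ring]
        refine h.trans ?_
        rw [Real.norm_eq_abs, abs_mul, Nat.abs_cast, mul_comm]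
        have : (t : ℝ) ≤ Lc := by exact_mod_cast (Finset.mem_range.1 ht).le
        exact mul_le_mul_of_nonneg_right this (abs_nonneg _)
    _ = (Lc : ℝ) * |y| * Lc := by rw [Finset.sum_const, Finset.card_range, nsmul_eq_mul]; ring

omit [NeZero Lc] in
/-- [folklore] `‖cellT‖ ≤ 1` for every label (a mean of unimodular numbers). -/
theorem norm_cellT_le_one (pr : Fin D → ℝ) (m' : TorusSite D N') : ‖cellT N' Lc pr m'‖ ≤ 1 := by
  rcases Nat.eq_zero_or_pos Lc with hL | hL
  · subst hL
    unfold cellT AliasObjects.gs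
    rcases Nat.eq_zero_or_pos D with hD | hD
    · subst hD; simp
    · simp [zero_pow hD.ne']
  haveI : NeZero Lc := ⟨hL.ne'⟩
  unfold cellT
  have e : ((Lc : ℂ) ^ D)⁻¹ * ∏ i, gs (kAl N' (ofRealVec pr) m' i) Lc = ∏ i, (gs (kAl N' (ofRealVec pr) m' i) Lc / (Lc : ℂ)) := by
    rw [Finset.prod_div_distrib, Finset.prod_const, Finset.card_univ, Fintype.card_fin]; ring
  rw [e, norm_prod]
  refine Finset.prod_le_one (fun i _ => norm_nonneg _) fun i _ => ?_
  rw [kAl_eq_kSym_add, gs_add_two_pi_mul, AliasReindex.kSym_apply]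
  have hr : (ofRealVec pr i + 2 * π * (srep m' i : ℂ)) / (N' : ℂ) = (((pr i + 2 * π * (srep m' i : ℝ)) / N' : ℝ) : ℂ) := by
    simp only [ofRealVec]; push_cast; ring
  rw [hr]
  exact norm_gs_div_le_one _

omit [NeZero Lc] in
/-- [folklore] AT THE LIFTED LABEL the cell factor is a function of `P/N′`: `cellT N′ Lc pr (lift N′ m) = Π_i gs (P_i/N′) Lc / Lc`. -/
theorem cellT_lift_eq (hNN' : N ≤ N') (pr : Fin D → ℝ) (m : TorusSite D N) :
    cellT N' Lc pr (lift N' m) = ∏ i, gs (((qlab pr m i / N' : ℝ)) : ℂ) Lc / (Lc : ℂ) := by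
  unfold cellT
  rw [Finset.prod_div_distrib, Finset.prod_const, Finset.card_univ, Fintype.card_fin, inv_mul_eq_div]
  congr 1
  refine Finset.prod_congr rfl fun i _ => ?_
  rw [kAl_eq_kSym_add, gs_add_two_pi_mul, kSym_lift hNN']
  congr 1
  unfold qlab
  simp only [ofRealVec]; push_cast; ring

/-- [folklore] **(A-cell)**: `‖cellT N′ Lc pr (lift N′ m) − 1‖ ≤ (Σ_i |P_i|)/N` at `N′ = N·Lc` (`|gs(P_i/N′)/Lc − 1| ≤ Lc·|P_i|/N′ = |P_i|/N`, telescoped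
over the coordinates against the unit bounds). -/
theorem norm_cellT_lift_sub_one_le (hN' : N' = N * Lc) (pr : Fin D → ℝ) (m : TorusSite D N) :
    ‖cellT N' Lc pr (lift N' m) - 1‖ ≤ (∑ i, |qlab pr m i|) / N := by
  have hNN' : N ≤ N' := by rw [hN']; exact Nat.le_mul_of_pos_right N (Nat.pos_of_ne_zero (NeZero.ne Lc))
  have hNr : (0 : ℝ) < N := by exact_mod_cast Nat.pos_of_ne_zero (NeZero.ne N)
  have hN'r : (N' : ℝ) = N * Lc := by rw [hN']; push_cast; ring
  have hLr : (Lc : ℝ) ≠ 0 := Nat.cast_ne_zero.2 (NeZero.ne Lc)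
  rw [cellT_lift_eq hNN']
  have h := norm_prod_sub_prod_le (Finset.univ : Finset (Fin D)) (a := fun _ => (1 : ℂ))
    (a' := fun i => gs (((qlab pr m i / N' : ℝ)) : ℂ) Lc / (Lc : ℂ)) (w := fun _ => (1 : ℝ)) (δ := fun i => |qlab pr m i| / N)
    (fun _ => zero_le_one) (fun _ => by simp) (fun i => norm_gs_div_le_one _) (fun i => by
      refine (norm_gs_div_sub_one_le _).trans (le_of_eq ?_)
      rw [abs_div, Nat.abs_cast, hN'r]
      field_simp)
  simp only [Finset.prod_const_one] at h
  simpa [Finset.sum_div] using h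

end Cell

/-! ## §2 The per-label matched bound -/

/-- THE PER-LABEL WEIGHT `wt pr m = (1 + ρ)·WS(P)·(s²/ρ²)`. -/
def wt {N : ℕ} (pr : Fin D → ℝ) (m : TorusSite D N) : ℝ :=
  (1 + rho (qlab pr m)) * (WS (qlab pr m) * (momSq pr / momSq (qlab pr m)))

/-- The per-label MATCHED constant `KM D = D·KB + KA`. -/
def KM (D : ℕ) : ℝ := D * KB D + KA D

section Matched

variable {N N' Lc : ℕ} [NeZero N] [NeZero N'] [NeZero Lc]

omit [NeZero N] in
/-- [folklore] `0 ≤ wt`. -/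
theorem wt_nonneg (pr : Fin D → ℝ) (m : TorusSite D N) : 0 ≤ wt pr m := by
  unfold wt
  exact mul_nonneg (by linarith [rho_nonneg (qlab pr m)])
    (mul_nonneg (WS_pos _).le (div_nonneg (momSq_nonneg _) (momSq_nonneg _)))

/-- [folklore] **THE PER-LABEL MATCHED BOUND**: `‖cellT·Ã_{N′}(lift N′ m)_κ − Ã_N(m)_κ‖ ≤ (KM/N)·wt pr m`, `N′ = N·Lc`, EVERY alias class `m`. -/
theorem norm_matched_le (hN : 1 ≤ N) (hN' : N' = N * Lc) {pr : Fin D → ℝ} (hq : ∀ i, |pr i| ≤ π) (hq0 : pr ≠ 0) (l : Fin D)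
    (m : TorusSite D N) (κ : Fin D) :
    ‖cellT N' Lc pr (lift N' m) * ampT N' pr l (lift N' m) κ - ampT N pr l m κ‖ ≤ KM D / N * wt pr m := by
  have hNN' : N ≤ N' := by rw [hN']; exact Nat.le_mul_of_pos_right N (Nat.pos_of_ne_zero (NeZero.ne Lc))
  have hNr : (0 : ℝ) < N := by exact_mod_cast hN
  set P := qlab pr m with hP
  have hρ0 : 0 ≤ rho P := rho_nonneg P
  have hW : 0 ≤ WS P := (WS_pos P).le
  have ht0 : 0 ≤ momSq pr / momSq P := div_nonneg (momSq_nonneg _) (momSq_nonneg _)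
  have hKB := KB_nonneg D; have hD : (0 : ℝ) ≤ D := Nat.cast_nonneg D
  -- the two pieces
  have hcell := norm_cellT_lift_sub_one_le (D := D) hN' pr m
  have hA' : ‖ampT N' pr l (lift N' m) κ‖ ≤ KB D * (WS P * (momSq pr / momSq P)) := by
    have h := norm_ampT_le_KB (hN.trans hNN') hq hq0 l (lift N' m) κ
    rwa [qlab_lift hNN'] at h
  have hrate := norm_ampT_lift_sub_le_KA hN hNN' hq hq0 l m κ
  have hsum : (∑ i, |P i|) / N ≤ D * rho P / N := by
    apply div_le_div_of_nonneg_right _ hNr.le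
    calc ∑ i, |P i| ≤ ∑ _i : Fin D, rho P := Finset.sum_le_sum fun i _ => abs_apply_le_rho P i
      _ = D * rho P := by rw [Finset.sum_const, Finset.card_univ, Fintype.card_fin, nsmul_eq_mul]
  have e : cellT N' Lc pr (lift N' m) * ampT N' pr l (lift N' m) κ - ampT N pr l m κ
      = (cellT N' Lc pr (lift N' m) - 1) * ampT N' pr l (lift N' m) κ + (ampT N' pr l (lift N' m) κ - ampT N pr l m κ) := by ring
  rw [e]
  calc ‖(cellT N' Lc pr (lift N' m) - 1) * ampT N' pr l (lift N' m) κ + (ampT N' pr l (lift N' m) κ - ampT N pr l m κ)‖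
      ≤ ‖cellT N' Lc pr (lift N' m) - 1‖ * ‖ampT N' pr l (lift N' m) κ‖ + ‖ampT N' pr l (lift N' m) κ - ampT N pr l m κ‖ := by
        refine (norm_add_le _ _).trans (add_le_add (le_of_eq (norm_mul _ _)) le_rfl)
    _ ≤ (D * rho P / N) * (KB D * (WS P * (momSq pr / momSq P))) + KA D * ((1 + rho P) / N * (WS P * (momSq pr / momSq P))) :=
        add_le_add (mul_le_mul (hcell.trans hsum) hA' (norm_nonneg _) (by positivity)) hrate
    _ ≤ (D * (1 + rho P) / N) * (KB D * (WS P * (momSq pr / momSq P))) + KA D * ((1 + rho P) / N * (WS P * (momSq pr / momSq P))) := by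
        gcongr; linarith
    _ = KM D / N * wt pr m := by unfold KM wt; ring

end Matched

/-! ## §3 The weight in King's currency and its N-uniform alias sum -/

/-- The pointWeight constant `KP D = 4^D·D·(1 + 3π√D)`. -/
def KP (D : ℕ) : ℝ := (4 : ℝ) ^ D * D * (1 + 3 * π * Real.sqrt D)

/-- The N-uniform alias-sum constant `KW D = 1 + π√D + KP·(3π)·3^D·aliasConst D 0`. -/
def KW (D : ℕ) : ℝ := 1 + π * Real.sqrt D + KP D * ((3 * π) * (3 : ℝ) ^ D * aliasConst D 0)

section Weight

variable {N : ℕ} [NeZero N] {pr : Fin D → ℝ}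

omit [NeZero N] in
/-- [folklore] A NONZERO label coordinate is far: `π·|srep m i| ≤ |P_i|` (`|pr_i| ≤ π`, `srep m i ≠ 0`). -/
theorem pi_mul_abs_srep_le (hq : ∀ i, |pr i| ≤ π) (m : TorusSite D N) {i : Fin D} (hi : srep m i ≠ 0) :
    π * |((srep m i : ℤ) : ℝ)| ≤ |qlab pr m i| := by
  have h1 : (1 : ℝ) ≤ |((srep m i : ℤ) : ℝ)| := by rw [← Int.cast_abs]; exact_mod_cast Int.one_le_abs hi
  have hπ := Real.pi_pos
  unfold qlab
  have h3 : |2 * π * ((srep m i : ℤ) : ℝ)| - |pr i| ≤ |pr i + 2 * π * ((srep m i : ℤ) : ℝ)| := by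
    have := abs_sub_abs_le_abs_sub (2 * π * ((srep m i : ℤ) : ℝ)) (-(pr i))
    rw [abs_neg, sub_neg_eq_add, add_comm] at this
    exact this
  rw [abs_mul, abs_of_pos (by positivity : (0:ℝ) < 2 * π)] at h3
  nlinarith [hq i]

omit [NeZero N] in
/-- [folklore] One coordinate of the weight: `wS (P_i) ≤ 4·[srep m i = 0 ? 1 : |srep m i|⁻¹]` (`12/(π|s|) ≤ 4/|s|`). -/
theorem wS_qlab_le (hq : ∀ i, |pr i| ≤ π) (m : TorusSite D N) (i : Fin D) :
    wS (qlab pr m i) ≤ 4 * (if srep m i = 0 then (1 : ℝ) else |((srep m i : ℤ) : ℝ)|⁻¹) := by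
  by_cases hi : srep m i = 0
  · rw [if_pos hi]; linarith [wS_le_one (qlab pr m i)]
  · rw [if_neg hi]
    have hs : 0 < |((srep m i : ℤ) : ℝ)| := by
      rw [← Int.cast_abs]; exact_mod_cast Int.one_le_abs hi
    have hP := pi_mul_abs_srep_le hq m hi
    have hP0 : qlab pr m i ≠ 0 := by
      intro h; rw [h, abs_zero] at hP; nlinarith [Real.pi_pos]
    have hπ3 := Real.pi_gt_three
    calc wS (qlab pr m i) ≤ 12 / |qlab pr m i| := wS_le_div hP0
      _ ≤ 12 / (π * |((srep m i : ℤ) : ℝ)|) := div_le_div_of_nonneg_left (by norm_num) (by positivity) hP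
      _ ≤ 4 * |((srep m i : ℤ) : ℝ)|⁻¹ := by
          rw [div_le_iff₀ (by positivity)]
          field_simp
          nlinarith

omit [NeZero N] in
/-- [folklore] **`WS P ≤ 4^D·Π_i [srep m i = 0 ? 1 : |srep m i|⁻¹]`**. -/
theorem WS_qlab_le_prod (hq : ∀ i, |pr i| ≤ π) (m : TorusSite D N) :
    WS (qlab pr m) ≤ (4 : ℝ) ^ D * ∏ i, (if srep m i = 0 then (1 : ℝ) else |((srep m i : ℤ) : ℝ)|⁻¹) := by
  unfold WS
  calc ∏ i, wS (qlab pr m i) ≤ ∏ i, (4 * (if srep m i = 0 then (1 : ℝ) else |((srep m i : ℤ) : ℝ)|⁻¹)) :=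
        Finset.prod_le_prod (fun i _ => (wS_pos _).le) fun i _ => wS_qlab_le hq m i
    _ = (4 : ℝ) ^ D * ∏ i, (if srep m i = 0 then (1 : ℝ) else |((srep m i : ℤ) : ℝ)|⁻¹) := by
        rw [Finset.prod_mul_distrib, Finset.prod_const, Finset.card_univ, Fintype.card_fin]

omit [NeZero N] in
/-- [folklore] **The symmetric representative is controlled by the label modulus**: `‖srep m‖∞ ≤ ρ/π`. -/
theorem norm_realVec_srep_le (hq : ∀ i, |pr i| ≤ π) (m : TorusSite D N) : ‖realVec (srep m)‖ ≤ rho (qlab pr m) / π := by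
  have hπ := Real.pi_pos
  refine (pi_norm_le_iff_of_nonneg (div_nonneg (rho_nonneg _) hπ.le)).2 fun i => ?_
  rw [Real.norm_eq_abs]
  show |((srep m i : ℤ) : ℝ)| ≤ rho (qlab pr m) / π
  rw [le_div_iff₀ hπ, mul_comm]
  by_cases hi : srep m i = 0
  · rw [hi]; simp [rho_nonneg]
  · exact (pi_mul_abs_srep_le hq m hi).trans (abs_apply_le_rho _ i)

omit [NeZero N] in
/-- [folklore] … and controls it: `ρ ≤ √D·(π + 2π·‖srep m‖∞)`. -/
theorem rho_qlab_le_norm (hq : ∀ i, |pr i| ≤ π) (m : TorusSite D N) :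
    rho (qlab pr m) ≤ Real.sqrt D * (π + 2 * π * ‖realVec (srep m)‖) := by
  have hπ := Real.pi_pos
  set F := ‖realVec (srep m)‖ with hF
  have hF0 : 0 ≤ F := norm_nonneg _
  have hcoord : ∀ i, |qlab pr m i| ≤ π + 2 * π * F := fun i => by
    unfold qlab
    calc |pr i + 2 * π * ((srep m i : ℤ) : ℝ)| ≤ |pr i| + |2 * π * ((srep m i : ℤ) : ℝ)| := abs_add_le _ _
      _ = |pr i| + 2 * π * |((srep m i : ℤ) : ℝ)| := by rw [abs_mul, abs_of_pos (by positivity : (0:ℝ) < 2 * π)]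
      _ ≤ π + 2 * π * F := add_le_add (hq i) (mul_le_mul_of_nonneg_left (abs_le_norm_realVec (srep m) i) (by positivity))
  unfold rho
  have hsum : momSq (qlab pr m) ≤ D * (π + 2 * π * F) ^ 2 := by
    unfold momSq
    calc ∑ i, qlab pr m i ^ 2 ≤ ∑ _i : Fin D, (π + 2 * π * F) ^ 2 := Finset.sum_le_sum fun i _ => by
          rw [← sq_abs]; exact pow_le_pow_left₀ (abs_nonneg _) (hcoord i) 2
      _ = D * (π + 2 * π * F) ^ 2 := by rw [Finset.sum_const, Finset.card_univ, Fintype.card_fin, nsmul_eq_mul]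
  calc Real.sqrt (momSq (qlab pr m)) ≤ Real.sqrt (D * (π + 2 * π * F) ^ 2) := Real.sqrt_le_sqrt hsum
    _ = Real.sqrt D * (π + 2 * π * F) := by rw [Real.sqrt_mul (Nat.cast_nonneg D), Real.sqrt_sq (by positivity)]

omit [NeZero N] in
/-- [folklore] **THE WEIGHT IN KING's CURRENCY** (`m ≠ 0`): `wt pr m ≤ KP·pointWeight 0 (srep m)` — ONE inverse power of `‖srep m‖∞`
(King exponent `α = 0 < 1`, window-free) times the coordinate product. -/
theorem wt_le_pointWeight (hq : ∀ i, |pr i| ≤ π) {m : TorusSite D N} (hm : m ≠ 0) : wt pr m ≤ KP D * pointWeight 0 (srep m) := by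
  have hπ := Real.pi_pos; have hπ3 := Real.pi_gt_three
  set P := qlab pr m with hP
  set F := ‖realVec (srep m)‖ with hF
  set Pw := ∏ i, (if srep m i = 0 then (1 : ℝ) else |((srep m i : ℤ) : ℝ)|⁻¹) with hPw
  have hF1 : 1 ≤ F := one_le_norm_realVec (srep_ne_zero hm); have hF0 : 0 < F := by linarith
  have hPw0 : 0 ≤ Pw := Finset.prod_nonneg fun i _ => by split_ifs <;> positivity
  have hρF : π * F ≤ rho P := by
    have := norm_realVec_srep_le hq m; rwa [le_div_iff₀ hπ, mul_comm] at this
  have hρ0 : 0 < rho P := lt_of_lt_of_le (by positivity) hρF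
  have hρup : rho P ≤ Real.sqrt D * (π + 2 * π * F) := rho_qlab_le_norm hq m
  have hD1 : (0 : ℝ) ≤ Real.sqrt D := Real.sqrt_nonneg _; have hDn : (0 : ℝ) ≤ D := Nat.cast_nonneg D
  -- the three factors
  have hW : WS P ≤ (4 : ℝ) ^ D * Pw := WS_qlab_le_prod hq m
  have ht : momSq pr / momSq P ≤ D / F ^ 2 := by
    have hs : momSq pr ≤ D * π ^ 2 := CapacitanceRateScaled.momSq_le hq
    have hρ2 : (π * F) ^ 2 ≤ momSq P := by rw [← rho_sq]; exact pow_le_pow_left₀ (by positivity) hρF 2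
    calc momSq pr / momSq P ≤ (D * π ^ 2) / (π * F) ^ 2 :=
          div_le_div₀ (by positivity) hs (by positivity) hρ2
      _ = D / F ^ 2 := by field_simp
  have h1 : 1 + rho P ≤ (1 + 3 * π * Real.sqrt D) * F := by
    have : Real.sqrt D * (π + 2 * π * F) ≤ 3 * π * Real.sqrt D * F := by nlinarith [mul_nonneg hD1 hπ.le]
    nlinarith
  have hpw : pointWeight 0 (srep m) = F⁻¹ * Pw := by
    unfold pointWeight; rw [zero_sub, Real.rpow_neg_one]
  rw [hpw]
  unfold wt KP
  calc (1 + rho P) * (WS P * (momSq pr / momSq P))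
      ≤ ((1 + 3 * π * Real.sqrt D) * F) * (((4 : ℝ) ^ D * Pw) * (D / F ^ 2)) := by
        have hdiv : 0 ≤ momSq pr / momSq P := div_nonneg (momSq_nonneg _) (momSq_nonneg _)
        exact mul_le_mul h1 (mul_le_mul hW ht hdiv (mul_nonneg (by positivity) hPw0))
          (mul_nonneg (WS_pos P).le hdiv) (by positivity)
    _ = (4 : ℝ) ^ D * D * (1 + 3 * π * Real.sqrt D) * (F⁻¹ * Pw) := by field_simp

omit [NeZero N] in
/-- [folklore] `srep 0 = 0`, so the zero alias' label is the coarse momentum itself: `qlab pr 0 = pr`. -/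
theorem qlab_zero (pr : Fin D → ℝ) : qlab pr (0 : TorusSite D N) = pr := by
  funext i
  unfold qlab
  rw [srep_apply]
  simp

omit [NeZero N] in
/-- [folklore] THE ZERO ALIAS: `wt pr 0 ≤ 1 + π√D` (`WS ≤ 1`, `s²/ρ² = 1`, `ρ = s ≤ π√D`). -/
theorem wt_zero_le (hq : ∀ i, |pr i| ≤ π) (hq0 : pr ≠ 0) : wt pr (0 : TorusSite D N) ≤ 1 + π * Real.sqrt D := by
  unfold wt
  rw [qlab_zero]
  have hs : momSq pr / momSq pr = 1 := div_self (momSq_pos hq0).ne'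
  rw [hs, mul_one]
  have hW := WS_le_one pr
  have hW0 := (WS_pos pr).le
  have hρ : rho pr ≤ π * Real.sqrt D := by
    unfold rho
    calc Real.sqrt (momSq pr) ≤ Real.sqrt (D * π ^ 2) := Real.sqrt_le_sqrt (CapacitanceRateScaled.momSq_le hq)
      _ = π * Real.sqrt D := by rw [Real.sqrt_mul (Nat.cast_nonneg D), Real.sqrt_sq Real.pi_pos.le]; ring
  have hρ0 := rho_nonneg pr
  nlinarith

/-- [folklore] **THE N-UNIFORM ALIAS SUM OF THE MATCHED WEIGHTS**: `Σ_{m : TorusSite D N} wt pr m ≤ KW D` (`D ≥ 1`; King 1986 (4.22) at `α = 0` through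
leaf-16's `AliasPointSum.sum_pointWeight_srep_le`, plus the zero alias). -/
theorem sum_wt_le (hD : 0 < D) (hq : ∀ i, |pr i| ≤ π) (hq0 : pr ≠ 0) : ∑ m : TorusSite D N, wt pr m ≤ KW D := by
  classical
  have hsplit : ∑ m : TorusSite D N, wt pr m
      = wt pr (0 : TorusSite D N) + ∑ m ∈ (Finset.univ : Finset (TorusSite D N)).filter (fun m => m ≠ 0), wt pr m := by
    rw [← Finset.add_sum_erase _ _ (Finset.mem_univ (0 : TorusSite D N))]
    congr 1
    refine Finset.sum_congr ?_ fun _ _ => rfl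
    ext m; simp [Finset.mem_erase, and_comm]
  rw [hsplit]
  have hK := sum_pointWeight_srep_le (D := D) (N := N) hD (α := (0 : ℝ)) (by norm_num)
  norm_num at hK
  have hKP : 0 ≤ KP D := by unfold KP; positivity
  have htail : ∑ m ∈ (Finset.univ : Finset (TorusSite D N)).filter (fun m => m ≠ 0), wt pr m
      ≤ KP D * ((3 * π) * (3 : ℝ) ^ D * aliasConst D 0) := by
    calc ∑ m ∈ (Finset.univ : Finset (TorusSite D N)).filter (fun m => m ≠ 0), wt pr m
        ≤ ∑ m ∈ (Finset.univ : Finset (TorusSite D N)).filter (fun m => m ≠ 0), KP D * pointWeight 0 (srep m) :=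
          Finset.sum_le_sum fun m hm => wt_le_pointWeight hq (Finset.mem_filter.1 hm).2
      _ = KP D * ∑ m ∈ (Finset.univ : Finset (TorusSite D N)).filter (fun m => m ≠ 0), pointWeight 0 (srep m) := by
          rw [Finset.mul_sum]
      _ ≤ KP D * ((3 * π) * (3 : ℝ) ^ D * aliasConst D 0) := mul_le_mul_of_nonneg_left hK hKP
  unfold KW
  linarith [wt_zero_le (N := N) hq hq0, htail]

end Weight

/-! ## §4 The matched half of the holder's (S2) -/

section Total

variable {N N' Lc : ℕ} [NeZero N] [NeZero N'] [NeZero Lc]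

/-- [folklore] **PART A, CONSUMER FORM — THE MATCHED SUM IS `O(1/N)` UNIFORMLY**: for `N′ = N·Lc`, `D ≥ 1`, real `pr ∈ [−π, π]^D ∖ {0}`,
`Σ_{m : TorusSite D N} ‖cellT N′ Lc pr (lift N′ m)·Ã_{N′}(lift N′ m)_κ − Ã_N(m)_κ‖ ≤ KM·KW/N`
(`Ã = N^{D+1}·Ahat N (ofRealVec pr) 0 (eVec l)`; at `N = Lc^{n+1}` this is `c·(Lc⁻¹)^{n+1}` — the rate `θ = Lc⁻¹` of «(N1-Cauchy)»). -/
theorem sum_norm_matched_le (hD : 0 < D) (hN : 1 ≤ N) (hN' : N' = N * Lc) {pr : Fin D → ℝ} (hq : ∀ i, |pr i| ≤ π) (hq0 : pr ≠ 0)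
    (l κ : Fin D) :
    ∑ m : TorusSite D N, ‖cellT N' Lc pr (lift N' m) * ampT N' pr l (lift N' m) κ - ampT N pr l m κ‖ ≤ KM D * KW D / N := by
  have hNr : (0 : ℝ) < N := by exact_mod_cast hN
  have hKM : 0 ≤ KM D := by
    have := KB_nonneg D; have := KA_nonneg D; unfold KM; positivity
  calc ∑ m : TorusSite D N, ‖cellT N' Lc pr (lift N' m) * ampT N' pr l (lift N' m) κ - ampT N pr l m κ‖
      ≤ ∑ m : TorusSite D N, KM D / N * wt pr m := Finset.sum_le_sum fun m _ => norm_matched_le hN hN' hq hq0 l m κ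
    _ = KM D / N * ∑ m : TorusSite D N, wt pr m := by rw [Finset.mul_sum]
    _ ≤ KM D / N * KW D := mul_le_mul_of_nonneg_left (sum_wt_le hD hq hq0) (by positivity)
    _ = KM D * KW D / N := by ring

end Total

end Summit.QuantumFields.BalabanUV.Beta.GAN24.FineReadoutCauchyMatchedSum

end
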